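import Mathlib
import Summits.MatrixMultiplication.Statement
import Summits.MatrixMultiplication.MatrixMultiplication.Theorems.GraphEquationsKernelTowers

/-!
# The quartic specimen: `¬ TowerReach 4 1 2` and `¬ KernelFieldClauseDeg 4 2` (`GraphEquations`, M80)

Decomp-mm node «GraphEquations» (lens 5); attacked leaf `MultiplicityReduction` (stmt-MatrixMultiplication-27806);
target of the node, VERBATIM: `_root_.MatrixMultiplication`; the cut `closes (hV : GraphEquationsQuadratic)
(hM : MultiplicityReduction)` is untouched — this file sits under `hM` via the degree ladder (M70) and the
kernel-tower dial `TowerReach` (M79).  **Decided: `h₂(4) ≥ 2`.**  At test degree `4`, ONE round of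
differentiation along a kernel field does not always reach order `2`: `not_towerReach_four_one_two`; hence, by
M79 `towerReach_one_of_kernelFieldClauseDeg` (the granted corollary), `not_kernelFieldClauseDeg_four_two`.

**Specimen** («slave compression»; `n·n ≥ 5`, positions `p₀..p₄ = v₁, v₂, z, ℓ, ℓ'`; fibre coordinates
`F_q = f_q`, `α_q := c_q − f_q`).  Slaves `s := f_ℓ + c_{v₁}f_{v₁} − f_{v₁}²`, `s' := f_{ℓ'} + c_{v₂}f_{v₁} − f_{v₁}f_{v₂}`
(lifts `F_ℓ + α₀F_{v₁}`, `F_{ℓ'} + α₁F_{v₁}`, LINEAR); carriers `K_r := f_{v₁}c_r² + 2f_lf_r + c_rf_l − f_rf_l`,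
`(r,l) ∈ {(v₁,ℓ), (v₂,ℓ')}`, lifting to `F_{v₁}F_r² + (2F_r + α_r)(F_l + α_rF_{v₁})` — a fibre CUBIC is carried
at test degree `4` because its Lemma-R companion is absorbed by a linear slave; tests
`t₁ := f_z + f_{v₁}² − f_{v₂}² + K_{v₁}`, `t₂ := f_{v₁}f_z + K_{v₁} − K_{v₂}`, `t₃ := f_z²`, and `f_q` elsewhere:
correct (`t₁, t₂ ⇒ f_{v₁}⁴ = 0`), degree `≤ 4`.  Kernel fields at a base pair: `μ_ℓ = −α₀μ_{v₁}`, `μ_{ℓ'} = −α₁μ_{v₁}`,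
`μ_z = 0`, `μ_w = 0` elsewhere, `p := (μ_{v₁}, μ_{v₂})` FREE.  For `p ≠ 0` the ARC `F = s u + s² x` of `arcU`/`arcX`
kills every member of `T ∪ D_μT` to order `s³` (`arcP_dvd`: exact identities); for `p = 0` the arc
`u = e_{v₂}, x = e_z` does (`arc0_dvd`); an arc killing the generators to order `s^N`, `u ≠ 0`, forbids ideal-initial
isolation of every order `< N` (`not_idealInitIsolatedSet_of_arcCert`, two-jet form of the masking certificate M71).
No `sorry`.  Sources: Leykin–Verschelde–Zhao, TCS 359 (2006) 111–122 [doi:10.1016/j.tcs.2006.02.018] §4 (iterated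
first-order deflation); [BurgisserClausenShokrollahi1997, Problem 16.3].
-/

set_option linter.dupNamespace false

noncomputable section

namespace Summit.MatrixMultiplication.MatrixMultiplication.Theorems.GraphEquations

open MvPolynomial Matrix Literature.Computability.AlgebraicComplexity Literature.Computability.AlgebraicComplexity.ArithCircuit

variable {n : ℕ}

section ArcCert

variable (u x : Fin n × Fin n → ℂ)

/-- The arc substitution `F_v ↦ u_v s + x_v s²` on `ℂ[F]`. -/
def arcHom : MvPolynomial (Fin n × Fin n) ℂ →ₐ[ℂ] Polynomial ℂ :=
  aeval fun v => Polynomial.C (u v) * Polynomial.X + Polynomial.C (x v) * Polynomial.X ^ 2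

/-- The arc of a coordinate. -/
@[simp] theorem arcHom_X (v : Fin n × Fin n) :
    arcHom u x (X v) = Polynomial.C (u v) * Polynomial.X + Polynomial.C (x v) * Polynomial.X ^ 2 := by simp [arcHom]

/-- The arc of a constant. -/
@[simp] theorem arcHom_C (a : ℂ) : arcHom u x (C a) = Polynomial.C a := by simp [arcHom, Polynomial.algebraMap_eq]

/-- The arc of a monomial: `g F^d ↦ s^{|d|} · g ∏_v (u_v + x_v s)^{d_v}`. -/
theorem arcHom_monomial (d : Fin n × Fin n →₀ ℕ) (g : ℂ) :
    arcHom u x (monomial d g) = Polynomial.X ^ d.degree *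
      (Polynomial.C g * ∏ v, (Polynomial.C (u v) + Polynomial.C (x v) * Polynomial.X) ^ d v) := by
  have hv : ∀ v, (Polynomial.C (u v) * Polynomial.X + Polynomial.C (x v) * Polynomial.X ^ 2) ^ d v =
      Polynomial.X ^ d v * (Polynomial.C (u v) + Polynomial.C (x v) * Polynomial.X) ^ d v := fun v => by
    rw [← mul_pow]; ring
  rw [arcHom, aeval_monomial, Finsupp.prod_fintype _ _ (fun v => by simp), Finsupp.degree_eq_sum,
    Polynomial.algebraMap_eq]
  simp only [hv, Finset.prod_mul_distrib, Finset.prod_pow_eq_pow_sum]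
  ring

/-- **Order count.**  If the components of `G` below `ν` vanish, the coefficient of `s^ν` in `arc(G)` is
`G_ν(u)`. -/
theorem coeff_arcHom (G : MvPolynomial (Fin n × Fin n) ℂ) {ν : ℕ} (hlow : ∀ j < ν, homogeneousComponent j G = 0) :
    (arcHom u x G).coeff ν = eval u (homogeneousComponent ν G) := by
  classical
  have hdeg : ∀ d ∈ G.support, ν ≤ d.degree := fun d hd => by
    by_contra hlt
    push Not at hlt
    have h := congr_arg (coeff d) (hlow _ hlt)
    rw [coeff_homogeneousComponent, if_pos rfl, coeff_zero] at h
    exact (mem_support_iff.1 hd) h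
  conv_lhs => rw [G.as_sum, map_sum, Polynomial.finsetSum_coeff]
  rw [homogeneousComponent_apply, map_sum, Finset.sum_filter]
  refine Finset.sum_congr rfl fun d hd => ?_
  rw [arcHom_monomial, Polynomial.coeff_X_pow_mul', eval_monomial, Finsupp.prod_fintype _ _ (fun v => by simp)]
  by_cases hdν : d.degree = ν
  · rw [if_pos hdν.le, if_pos hdν, hdν, Nat.sub_self, Polynomial.coeff_zero_eq_eval_zero]
    simp [Polynomial.eval_prod]
  · rw [if_neg (fun h => hdν (le_antisymm h (hdeg d hd))), if_neg hdν]

/-- **Arc certificate** (pointwise two-jet form of the masking certificate M71).  If over the base pair `y` every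
`t ∈ S`, in fibre coordinates, vanishes to order `s^N` along the arc `F = s u + s² x`, `u ≠ 0`, then `S` is
ideal-initially isolating of no order `K < N` over `y`: so does every member of `span S`, hence its initial form
of degree `ν ∈ [1, K]` vanishes at `u`, and `F₀ := u ≠ 0` passes the isolation test. -/
theorem not_idealInitIsolatedSet_of_arcCert {S : Set (MvPolynomial (GraphVars n) ℂ)} {K N : ℕ} (hKN : K < N)
    {y : MatMulVars n → ℂ} (hdiv : ∀ t ∈ S, Polynomial.X ^ N ∣ arcHom u x (map (eval y) (liftF n t)))
    (hu : u ≠ 0) : ¬ IdealInitIsolatedSet S K y := by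
  classical
  rintro ⟨T, w, hw, ν, G, hν, hG, hlow, hiso⟩
  let Φ : MvPolynomial (GraphVars n) ℂ →+* Polynomial ℂ :=
    ((arcHom u x).toRingHom.comp (map (eval y))).comp (liftF n).toRingHom
  have hspan : Ideal.span S ≤ Ideal.comap Φ (Ideal.span {Polynomial.X ^ N}) := by
    rw [Ideal.span_le]
    exact fun t ht => Ideal.mem_span_singleton.2 (hdiv t ht)
  have hdivG : ∀ i, Polynomial.X ^ N ∣ arcHom u x (map (eval y) (G i)) := fun i => by
    have h := Ideal.mem_span_singleton.1 (Ideal.mem_comap.1 (hspan (hw i)))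
    rw [← hG i] at h
    simpa [Φ, liftF_substF] using h
  have hcoef : ∀ i, 1 ≤ ν i → eval u (map (eval y) (homogeneousComponent (ν i) (G i))) = 0 := by
    intro i hi
    have hlow' : ∀ j < ν i, homogeneousComponent j (map (eval y) (G i)) = 0 := fun j hj => by
      rw [homogeneousComponent_map, hlow i j hj, map_zero]
    rw [← homogeneousComponent_map, ← coeff_arcHom u x _ hlow']
    obtain ⟨p, hp⟩ := hdivG i
    rw [hp, Polynomial.coeff_X_pow_mul', if_neg]
    have := hν i
    omega
  refine hu (hiso u fun i => ?_)
  rcases Nat.eq_zero_or_pos (ν i) with h0 | hpos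
  · rw [h0, eq_C_of_isHomogeneous_zero ((homogeneousComponent_isHomogeneous 0 (G i)).map (eval y)),
      eval_C, eval_C]
  · rw [eval_zero_of_isHomogeneous ((homogeneousComponent_isHomogeneous _ (G i)).map (eval y)) hpos.ne',
      hcoef i hpos]

end ArcCert

/-- The specialised lift of `D_μ t` is `D_{μ(y)}` of the specialised lift of `t`. -/
theorem map_liftF_derivC (μ : Fin n × Fin n → MvPolynomial (MatMulVars n) ℂ)
    (t : MvPolynomial (GraphVars n) ℂ) (y : MatMulVars n → ℂ) :
    map (eval y) (liftF n (derivC μ t)) = polarDeriv (fun q => eval y (μ q)) (map (eval y) (liftF n t)) := by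
  conv_lhs => rw [← substF_liftF t, ← substF_polarDeriv, liftF_substF]
  rw [map_polarDeriv]

/-- `D_μ t ∈ I(Γ)` read over a base pair: the constant term of `D_{μ(y)}` of the specialised lift vanishes. -/
theorem constantCoeff_polarDeriv_of_derivC_mem {μ : Fin n × Fin n → MvPolynomial (MatMulVars n) ℂ}
    {t : MvPolynomial (GraphVars n) ℂ} (h : derivC μ t ∈ graphIdeal n) (y : MatMulVars n → ℂ) :
    constantCoeff (polarDeriv (fun q => eval y (μ q)) (map (eval y) (liftF n t))) = 0 := by
  rw [← map_liftF_derivC, constantCoeff_map, (substF_mem_graphIdeal_iff _).1 (by rwa [substF_liftF]), map_zero]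

section Quartic

variable (h5 : 5 ≤ n * n)

/-- The five active positions `p₀, …, p₄` (`v₁, v₂, z, ℓ, ℓ'`). -/
def qP (j : Fin 5) : Fin n × Fin n := chainPos n ⟨j, lt_of_lt_of_le j.isLt h5⟩

/-- `f_j := f_{p_j}`. -/
def qf (j : Fin 5) : MvPolynomial (GraphVars n) ℂ := generator n (qP h5 j)

/-- `c_j := c_{p_j}`. -/
def qc (j : Fin 5) : MvPolynomial (GraphVars n) ℂ := X (Sum.inr (qP h5 j))

/-- The carrier `K_r := f₀ c_r² + 2 f_l f_r + c_r f_l − f_r f_l`. -/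
def qK (r l : Fin 5) : MvPolynomial (GraphVars n) ℂ :=
  qf h5 0 * qc h5 r * qc h5 r + (qf h5 l * qf h5 r + qf h5 l * qf h5 r) + qc h5 r * qf h5 l - qf h5 r * qf h5 l

/-- The five special tests `s, s', t₁, t₂, t₃`. -/
def quarticSpecial (j : Fin 5) : MvPolynomial (GraphVars n) ℂ :=
  if j.val = 0 then qf h5 3 + qc h5 0 * qf h5 0 - qf h5 0 * qf h5 0
  else if j.val = 1 then qf h5 4 + qc h5 1 * qf h5 0 - qf h5 0 * qf h5 1
  else if j.val = 2 then qf h5 2 + qf h5 0 * qf h5 0 - qf h5 1 * qf h5 1 + qK h5 0 3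
  else if j.val = 3 then qf h5 0 * qf h5 2 + qK h5 0 3 - qK h5 1 4
  else qf h5 2 * qf h5 2

/-- The quartic specimen's tests: the special five, and `f_q` at every other position. -/
def quarticTest (i : Fin (n * n)) : MvPolynomial (GraphVars n) ℂ :=
  if hi : i.val < 5 then quarticSpecial h5 ⟨i.val, hi⟩ else generator n (chainPos n i)

/-- Fibre coordinates over a base pair (`a_r = α_r(y)`): the linear slave forms `F_l + a_r F₀`. -/
def qS (a : Fin 5 → ℂ) (r l : Fin 5) : MvPolynomial (Fin n × Fin n) ℂ := X (qP h5 l) + C (a r) * X (qP h5 0)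

/-- `E₁ = F₂ + F₀² − F₁² + F₀³`. -/
def qE₁ : MvPolynomial (Fin n × Fin n) ℂ :=
  X (qP h5 2) + X (qP h5 0) * X (qP h5 0) - X (qP h5 1) * X (qP h5 1) + X (qP h5 0) * X (qP h5 0) * X (qP h5 0)

/-- `E₂ = F₀ F₂ + F₀³ − F₀ F₁²`. -/
def qE₂ : MvPolynomial (Fin n × Fin n) ℂ :=
  X (qP h5 0) * X (qP h5 2) + X (qP h5 0) * X (qP h5 0) * X (qP h5 0) - X (qP h5 0) * X (qP h5 1) * X (qP h5 1)

/-- The specialised lifts of the special tests, in virtual form `s^, s'^, E₁ + A s^, E₂ + A s^ − B s'^, F₂²`. -/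
def quarticFib (a : Fin 5 → ℂ) (j : Fin 5) : MvPolynomial (Fin n × Fin n) ℂ :=
  if j.val = 0 then qS h5 a 0 3
  else if j.val = 1 then qS h5 a 1 4
  else if j.val = 2 then qE₁ h5 + (2 * X (qP h5 0) + C (a 0)) * qS h5 a 0 3
  else if j.val = 3 then qE₂ h5 + (2 * X (qP h5 0) + C (a 0)) * qS h5 a 0 3 - (2 * X (qP h5 1) + C (a 1)) * qS h5 a 1 4
  else X (qP h5 2) * X (qP h5 2)

/-- `(lift tⱼ)(y) = Gⱼ(α(y))`. -/
theorem map_liftF_quarticSpecial (y : MatMulVars n → ℂ) (j : Fin 5) :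
    map (eval y) (liftF n (quarticSpecial h5 j)) = quarticFib h5 (fun k => eval y (abBase n (qP h5 k))) j := by
  fin_cases j <;>
    simp [quarticSpecial, quarticFib, qK, qf, qc, qS, qE₁, qE₂, liftF_generator, liftF_X_inr_eq, map_X, map_C] <;>
    ring

/-- The tests have degree `≤ 4`. -/
theorem totalDegree_quarticTest_le (i : Fin (n * n)) : (quarticTest h5 i).totalDegree ≤ 4 := by
  have hf : ∀ j, (qf h5 j).totalDegree ≤ 2 := fun j => totalDegree_generator_le_two n _
  have hc : ∀ j, (qc h5 j).totalDegree ≤ 1 := fun j => (totalDegree_X _).le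
  have f4 : ∀ j, (qf h5 j).totalDegree ≤ 4 := fun j => (hf j).trans (by norm_num)
  have add : ∀ {p q : MvPolynomial (GraphVars n) ℂ}, p.totalDegree ≤ 4 → q.totalDegree ≤ 4 →
      (p + q).totalDegree ≤ 4 := fun hp hq => (totalDegree_add _ _).trans (max_le hp hq)
  have sub : ∀ {p q : MvPolynomial (GraphVars n) ℂ}, p.totalDegree ≤ 4 → q.totalDegree ≤ 4 →
      (p - q).totalDegree ≤ 4 := fun hp hq => (totalDegree_sub _ _).trans (max_le hp hq)
  have mul : ∀ {p q : MvPolynomial (GraphVars n) ℂ} {a b : ℕ}, p.totalDegree ≤ a → q.totalDegree ≤ b →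
      a + b ≤ 4 → (p * q).totalDegree ≤ 4 := fun hp hq h => (totalDegree_mul _ _).trans ((add_le_add hp hq).trans h)
  have hK : ∀ r l, (qK h5 r l).totalDegree ≤ 4 := fun r l =>
    sub (add (add ((totalDegree_mul _ _).trans (add_le_add ((totalDegree_mul _ _).trans
      (add_le_add (hf 0) (hc r))) (hc r))) (add (mul (hf l) (hf r) le_rfl) (mul (hf l) (hf r) le_rfl)))
      (mul (hc r) (hf l) (by norm_num))) (mul (hf r) (hf l) le_rfl)
  unfold quarticTest quarticSpecial
  split_ifs
  iterate 2 exact sub (add (f4 _) (mul (hc _) (hf _) (by norm_num))) (mul (hf _) (hf _) le_rfl)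
  · exact add (sub (add (f4 _) (mul (hf _) (hf _) le_rfl)) (mul (hf _) (hf _) le_rfl)) (hK _ _)
  · exact sub (add (mul (hf _) (hf _) le_rfl) (hK _ _)) (hK _ _)
  · exact mul (hf _) (hf _) le_rfl
  · exact (totalDegree_generator_le_two n _).trans (by norm_num)

/-- **Correctness**: the tests cut out `W_n` (`t₁, t₂ ⇒ f_{v₁}⁴ = 0`; then `t₃`, `t₁` and the slaves). -/
theorem quarticTest_zero_iff (x : GraphVars n → ℂ) : (∀ i, eval x (quarticTest h5 i) = 0) ↔ x ∈ mmGraph n := by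
  refine ⟨fun h => (mem_mmGraph_iff_eval_generator x).2 fun q => ?_, fun hx i => ?_⟩
  · obtain ⟨A, hc⟩ : ∃ A : Fin 5 → ℂ, ∀ j, eval x (qc h5 j) = eval x (qf h5 j) + A j :=
      ⟨fun j => eval x (liftAB n (abBase n (qP h5 j))), fun j => by simp only [liftAB_abBase, map_sub]; simp [qc, qf]⟩
    obtain ⟨g, hg⟩ : ∃ g : Fin 5 → ℂ, ∀ j, eval x (qf h5 j) = g j := ⟨_, fun _ => rfl⟩
    have hs : ∀ j : Fin 5, eval x (quarticSpecial h5 j) = 0 := fun j => by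
      have := h ⟨j, by omega⟩; rwa [quarticTest, dif_pos j.isLt, Fin.eta] at this
    have e0 := hs 0; have e1 := hs 1; have e2 := hs 2; have e3 := hs 3; have e4 := hs 4
    simp +decide only [quarticSpecial, qK, if_true, if_false, map_add, map_sub, map_mul, hc, hg] at e0 e1 e2 e3 e4
    have k0 : g 0 = 0 := pow_eq_zero_iff (n := 4) (by norm_num) |>.1 (by
      linear_combination g 0 * e2 - e3 + (2 * g 0 + A 0) * (1 - g 0) * e0 - (2 * g 1 + A 1) * e1)
    have k2 : g 2 = 0 := pow_eq_zero_iff (n := 2) (by norm_num) |>.1 (by linear_combination e4)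
    have k3 : g 3 = 0 := by linear_combination e0 - A 0 * k0
    have k1 : g 1 = 0 := pow_eq_zero_iff (n := 2) (by norm_num) |>.1 (by
      linear_combination (-1 : ℂ) * e2 + k2 + (g 0 + A 0) * k3 + (g 0 + (g 0 + A 0) * (g 0 + A 0) + g 3) * k0)
    have k4 : g 4 = 0 := by linear_combination e1 - A 1 * k0
    have hg0 : ∀ j : Fin 5, g j = 0 := fun j => by fin_cases j <;> assumption
    obtain ⟨i, rfl⟩ := exists_chainPos_eq q
    by_cases hi : i.val < 5
    · exact (hg ⟨i.val, hi⟩).trans (hg0 _)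
    · have := h i; rwa [quarticTest, dif_neg hi] at this
  · have hg : ∀ q, eval x (generator n q) = 0 := (mem_mmGraph_iff_eval_generator x).1 hx
    unfold quarticTest quarticSpecial qK qf
    split_ifs <;> simp [hg]

/-- **Kernel fields of the specimen, read at a base pair**: `μ_z(y) = 0`, `μ_ℓ(y) = −α₀(y) μ_{v₁}(y)`,
`μ_{ℓ'}(y) = −α₁(y) μ_{v₁}(y)`, `μ_w(y) = 0` at every other position (`μ_{v₁}, μ_{v₂}` are free). -/
theorem quartic_kernel_at {μ : Fin n × Fin n → MvPolynomial (MatMulVars n) ℂ}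
    (hker : ∀ i, derivC μ (quarticTest h5 i) ∈ graphIdeal n) (y : MatMulVars n → ℂ) :
    eval y (μ (qP h5 2)) = 0 ∧ eval y (μ (qP h5 3)) = -(eval y (abBase n (qP h5 0)) * eval y (μ (qP h5 0))) ∧
    eval y (μ (qP h5 4)) = -(eval y (abBase n (qP h5 1)) * eval y (μ (qP h5 0))) ∧
    ∀ i : Fin (n * n), ¬ i.val < 5 → eval y (μ (chainPos n i)) = 0 := by
  classical
  have hs : ∀ j : Fin 5, constantCoeff (polarDeriv (fun q => eval y (μ q))
      (quarticFib h5 (fun k => eval y (abBase n (qP h5 k))) j)) = 0 := fun j => by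
    have h := constantCoeff_polarDeriv_of_derivC_mem (hker ⟨j, by omega⟩) y
    rwa [quarticTest, dif_pos j.isLt, Fin.eta, map_liftF_quarticSpecial] at h
  have e0 := hs 0; have e1 := hs 1; have e2 := hs 2
  simp [quarticFib, qS, qE₁, polarDeriv_add, polarDeriv_sub', polarDeriv_mul, polarDeriv_X] at e0 e1 e2
  refine ⟨by linear_combination e2 - eval y (abBase n (qP h5 0)) * e0, by linear_combination e0,
    by linear_combination e1, fun i hi => ?_⟩
  have h := constantCoeff_polarDeriv_of_derivC_mem (hker i) y
  rwa [quarticTest, dif_neg hi, liftF_generator, map_X, polarDeriv_X, constantCoeff_C] at h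

/-- Vectors supported on the five positions. -/
def vecN (w : Fin 5 → ℂ) : Fin n × Fin n → ℂ := fun v =>
  if h : (finProdFinEquiv v).val < 5 then w ⟨_, h⟩ else 0

/-- `vecN w` along the chain enumeration. -/
theorem vecN_chainPos (w : Fin 5 → ℂ) (i : Fin (n * n)) :
    vecN w (chainPos n i) = if h : i.val < 5 then w ⟨_, h⟩ else 0 := by
  show (if h : (finProdFinEquiv (finProdFinEquiv.symm i)).val < 5 then w ⟨_, h⟩ else 0) = _
  simp only [Equiv.apply_symm_apply]

/-- `vecN w` at the five positions. -/
@[simp] theorem vecN_qP (w : Fin 5 → ℂ) (j : Fin 5) : vecN w (qP h5 j) = w j := by rw [qP, vecN_chainPos, dif_pos j.isLt]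

/-- The generic arc (`p = (μ_{v₁}(y), μ_{v₂}(y)) ≠ 0`): velocity `u = (2p₂, 2p₁, 0, −2α₀p₂, −2α₁p₂)` … -/
def arcU (p₁ p₂ a₀ a₁ : ℂ) : Fin 5 → ℂ := ![2 * p₂, 2 * p₁, 0, -(2 * a₀ * p₂), -(2 * a₁ * p₂)]

/-- … and acceleration `x = (0, 6p₁p₂, 4(p₁² − p₂²), 0, 0)`. -/
def arcX (p₁ p₂ : ℂ) : Fin 5 → ℂ := ![0, 6 * p₁ * p₂, 4 * (p₁ * p₁ - p₂ * p₂), 0, 0]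

/-- **The generic arc kills `T ∪ D_μ T` to order `s³`** (exact identities; `m = μ(y)` a kernel value). -/
theorem arcP_dvd (a : Fin 5 → ℂ) (m : Fin n × Fin n → ℂ) (p₁ p₂ : ℂ) (h0 : m (qP h5 0) = p₁) (h1 : m (qP h5 1) = p₂)
    (h2 : m (qP h5 2) = 0) (h3 : m (qP h5 3) = -(a 0 * p₁)) (h4 : m (qP h5 4) = -(a 1 * p₁)) (j : Fin 5) :
    Polynomial.X ^ 3 ∣ arcHom (vecN (arcU p₁ p₂ (a 0) (a 1))) (vecN (arcX p₁ p₂)) (quarticFib h5 a j) ∧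
      Polynomial.X ^ 3 ∣ arcHom (vecN (arcU p₁ p₂ (a 0) (a 1))) (vecN (arcX p₁ p₂))
        (polarDeriv m (quarticFib h5 a j)) := by
  classical
  obtain ⟨⟨P, hP⟩, ⟨Q, hQ⟩⟩ : (∃ P, Polynomial.C p₁ = P) ∧ (∃ Q, Polynomial.C p₂ = Q) := ⟨⟨_, rfl⟩, ⟨_, rfl⟩⟩
  fin_cases j <;> constructor <;>
    simp [quarticFib, qS, qE₁, qE₂, arcU, arcX, polarDeriv_add, polarDeriv_sub', polarDeriv_mul, polarDeriv_X,
      polarDeriv_ofNat, h0, h1, h2, h3, h4, map_ofNat, hP, hQ]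
  all_goals first
    | exact ⟨0, by ring1⟩
    | exact ⟨-36 * P ^ 2 * Q ^ 2 * Polynomial.X - 24 * P ^ 2 * Q + 8 * Q ^ 3, by ring1⟩
    | exact ⟨-72 * P ^ 2 * Q ^ 3 * Polynomial.X ^ 2 - 48 * P ^ 2 * Q ^ 2 * Polynomial.X, by ring1⟩
    | exact ⟨-36 * P ^ 3 * Q ^ 2 * Polynomial.X - 24 * P ^ 3 * Q - 24 * P * Q ^ 3, by ring1⟩
    | exact ⟨16 * Polynomial.X * (P ^ 2 - Q ^ 2) ^ 2, by ring1⟩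

/-- **The `p = 0` arc `u = e_{v₂}`, `x = e_z` kills `T ∪ D_μ T` to order `s³`** (there `μ(y) = 0` at `p₀..p₄`). -/
theorem arc0_dvd (a : Fin 5 → ℂ) (m : Fin n × Fin n → ℂ) (h0 : m (qP h5 0) = 0) (h1 : m (qP h5 1) = 0)
    (h2 : m (qP h5 2) = 0) (h3 : m (qP h5 3) = 0) (h4 : m (qP h5 4) = 0) (j : Fin 5) :
    Polynomial.X ^ 3 ∣ arcHom (vecN ![0, 1, 0, 0, 0]) (vecN ![0, 0, 1, 0, 0]) (quarticFib h5 a j) ∧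
      Polynomial.X ^ 3 ∣ arcHom (vecN ![0, 1, 0, 0, 0]) (vecN ![0, 0, 1, 0, 0]) (polarDeriv m (quarticFib h5 a j)) := by
  classical
  fin_cases j <;> constructor <;>
    simp [quarticFib, qS, qE₁, qE₂, polarDeriv_add, polarDeriv_sub', polarDeriv_mul, polarDeriv_X, polarDeriv_ofNat,
      h0, h1, h2, h3, h4, map_ofNat]
  all_goals first | exact ⟨0, by ring1⟩ | exact ⟨Polynomial.X, by ring1⟩

/-- Arc step: an arc on `p₀..p₄` killing the five virtual generators and their `D_{μ(y)}` to order `s³` rules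
out ideal-initial isolation of `T ∪ D_μ T` to every order `≤ 2`, for a system `E` realising the tests. -/
theorem quartic_arc_step {E : EqSystem n} (hto : ∀ j ∈ E.tests, ∃ i, E.testPoly j = quarticTest h5 i)
    {μ : Fin n × Fin n → MvPolynomial (MatMulVars n) ℂ} {y : MatMulVars n → ℂ}
    (krest : ∀ i : Fin (n * n), ¬ i.val < 5 → eval y (μ (chainPos n i)) = 0) (u x : Fin 5 → ℂ) (hu : u ≠ 0)
    (hdv : ∀ j : Fin 5, Polynomial.X ^ 3 ∣ arcHom (vecN u) (vecN x) (quarticFib h5 (fun k => eval y (abBase n (qP h5 k))) j) ∧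
      Polynomial.X ^ 3 ∣ arcHom (vecN u) (vecN x) (polarDeriv (fun q => eval y (μ q))
        (quarticFib h5 (fun k => eval y (abBase n (qP h5 k))) j))) {K : ℕ} (hK : K < 3) :
    ¬ IdealInitIsolatedSet (E.testSet ∪ derivC μ '' E.testSet) K y := by
  have hmem : ∀ t ∈ E.testSet, ∃ i, t = quarticTest h5 i := fun t ht => by
    obtain ⟨j, hj, rfl⟩ := (E.mem_testSet_iff t).1 ht
    exact hto j hj
  refine not_idealInitIsolatedSet_of_arcCert (vecN u) (vecN x) hK (fun t ht => ?_)
    fun h => hu (funext fun j => by simpa using congr_fun h (qP h5 j))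
  rcases ht with ht | ⟨t', ht', rfl⟩
  · obtain ⟨i, rfl⟩ := hmem t ht
    by_cases hi : i.val < 5
    · rw [quarticTest, dif_pos hi, map_liftF_quarticSpecial]; exact (hdv _).1
    · rw [quarticTest, dif_neg hi, liftF_generator, map_X, arcHom_X, vecN_chainPos, vecN_chainPos, dif_neg hi,
        dif_neg hi]; simp
  · obtain ⟨i, rfl⟩ := hmem t' ht'
    rw [map_liftF_derivC]
    by_cases hi : i.val < 5
    · rw [quarticTest, dif_pos hi, map_liftF_quarticSpecial]; exact (hdv _).2
    · rw [quarticTest, dif_neg hi, liftF_generator, map_X, polarDeriv_X, krest i hi, map_zero, map_zero]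
      exact dvd_zero _

/-- **One round never reaches order `2` on the quartic specimen**: for every kernel field `μ` and base pair `y`,
`T ∪ D_μ T` is ideal-initially isolating to no order `≤ 2` (generic arc where `p ≠ 0`, the `p = 0` arc elsewhere). -/
theorem quartic_one_round_not_order_two {E : EqSystem n} (hto : ∀ j ∈ E.tests, ∃ i, E.testPoly j = quarticTest h5 i)
    (hfrom : ∀ i, ∃ j ∈ E.tests, E.testPoly j = quarticTest h5 i) (μ : Fin n × Fin n → MvPolynomial (MatMulVars n) ℂ)
    (hker : ∀ j ∈ E.tests, derivC μ (E.testPoly j) ∈ graphIdeal n) {K : ℕ} (hK : K < 3) (y : MatMulVars n → ℂ) :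
    ¬ IdealInitIsolatedSet (E.testSet ∪ derivC μ '' E.testSet) K y := by
  classical
  have hkerI : ∀ i, derivC μ (quarticTest h5 i) ∈ graphIdeal n := fun i => by
    obtain ⟨j, hj, hji⟩ := hfrom i
    rw [← hji]; exact hker j hj
  obtain ⟨k2, k3, k4, krest⟩ := quartic_kernel_at h5 hkerI y
  by_cases hp : eval y (μ (qP h5 0)) = 0 ∧ eval y (μ (qP h5 1)) = 0
  · exact quartic_arc_step h5 hto krest _ _ (fun h => by simpa using congr_fun h 1)
      (arc0_dvd h5 _ _ hp.1 hp.2 k2 (by simpa [hp.1] using k3) (by simpa [hp.1] using k4)) hK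
  · exact quartic_arc_step h5 hto krest _ _
      (fun h => hp ⟨by simpa [arcU] using congr_fun h 1, by simpa [arcU] using congr_fun h 0⟩)
      (arcP_dvd h5 _ (fun q => eval y (μ q)) _ _ rfl rfl k2 k3 k4) hK

/-- **THE QUARTIC SPECIMEN.**  For `n² ≥ 5`: a CORRECT degree-`4` system which, together with every one-round
kernel deflation `T ∪ D_μ T` of it, is ideal-initially isolating to no order `≤ 2` over any base pair. -/
theorem exists_quarticSystem (h5 : 5 ≤ n * n) : ∃ E : EqSystem n, E.Correct ∧ E.IsDegLe 4 ∧
    (∀ K, K < 3 → ∀ y, ¬ IdealInitIsolatedSet E.testSet K y) ∧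
    ∀ μ : Fin n × Fin n → MvPolynomial (MatMulVars n) ℂ, (∀ t ∈ E.testSet, derivC μ t ∈ graphIdeal n) →
      ∀ K, K < 3 → ∀ y, ¬ IdealInitIsolatedSet (E.testSet ∪ derivC μ '' E.testSet) K y := by
  classical
  obtain ⟨E, hfan, hto, hfrom⟩ := exists_realisation_list ((List.finRange (n * n)).map (quarticTest h5))
  have hto' : ∀ j ∈ E.tests, ∃ i, E.testPoly j = quarticTest h5 i := fun j hj =>
    let ⟨i, _, hi⟩ := List.mem_map.1 (hto j hj); ⟨i, hi.symm⟩
  have hfrom' : ∀ i, ∃ j ∈ E.tests, E.testPoly j = quarticTest h5 i := fun i =>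
    hfrom _ (List.mem_map_of_mem (List.mem_finRange i))
  refine ⟨E, ⟨hfan, Set.ext fun x => ⟨fun hx => ?_, fun hx j hj => ?_⟩⟩, fun o => ?_, fun K hK y h => ?_,
    fun μ hμ K hK y => quartic_one_round_not_order_two h5 hto' hfrom' μ ((E.kernel_testSet_iff μ).1 hμ) hK y⟩
  · exact (quarticTest_zero_iff h5 x).1 fun i => by
      obtain ⟨j, hj, hji⟩ := hfrom' i; rw [← hji]; exact hx j hj
  · obtain ⟨i, hi⟩ := hto' j hj
    rw [hi]; exact (quarticTest_zero_iff h5 x).2 hx i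
  · obtain ⟨i, hi⟩ := hto' _ (List.get_mem _ o)
    rw [hi]; exact totalDegree_quarticTest_le h5 i
  · refine quartic_one_round_not_order_two h5 hto' hfrom' 0 (fun j hj => ?_) hK y  -- height 0: `T ⊆ T ∪ D_0 T`
      (h.mono (Ideal.span_mono Set.subset_union_left))
    rw [show derivC (0 : Fin n × Fin n → MvPolynomial (MatMulVars n) ℂ) (E.testPoly j) = 0 by simp [derivC]]
    exact Ideal.zero_mem _

end Quartic

/-- **`¬ TowerReach 4 1 2`**: at degree `4` no kernel tower of height `≤ 1` reaches order `2` — the quartic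
specimen over `n = 3` (height `0` fails to every order `≤ 2`, height `1` along every kernel field). -/
theorem not_towerReach_four_one_two : ¬ TowerReach 4 1 2 := by
  intro h
  obtain ⟨E, hE, hdeg, h0, h1⟩ := exists_quarticSystem (n := 3) (by norm_num)
  obtain ⟨μs, hlen, hT, y, hy⟩ := h 3 (by norm_num) E hE hdeg
  rcases μs with _ | ⟨μ, _ | ⟨ν, rest⟩⟩
  · exact h0 2 (by norm_num) y hy
  · exact h1 μ hT.1 2 (by norm_num) y hy
  · simp at hlen

/-- Hence `¬ TowerReach D 1 K` for all `D ≥ 4`, `K ≤ 2`. -/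
theorem not_towerReach_one_of_le {D K : ℕ} (hD : 4 ≤ D) (hK : K ≤ 2) : ¬ TowerReach D 1 K :=
  fun h => not_towerReach_four_one_two ((h.anti_deg hD).mono_order hK)

/-- **`¬ KernelFieldClauseDeg 4 2`** (the granted one-line corollary, via M79 `towerReach_one_of_kernelFieldClauseDeg`;
no new clause is declared): at degree `4`, one round of kernel-field deflation cannot be asked to reach order `2`. -/
theorem not_kernelFieldClauseDeg_four_two : ¬ KernelFieldClauseDeg 4 2 :=
  fun h => not_towerReach_four_one_two (towerReach_one_of_kernelFieldClauseDeg h)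

end Summit.MatrixMultiplication.MatrixMultiplication.Theorems.GraphEquations
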